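import Literature.MathematicalPhysics.QuantumLattice.HubbardModel
import Literature.MathematicalPhysics.QuantumLattice.FermionOperatorsProofs
import HarnessLib

/-!
# Discharges for the Hubbard model file (`HubbardModel`): Yang's `η`-pairing eigenstates

Trunk T-QLATTICE, family `hubbard`. Sibling proof file of
`Literature/MathematicalPhysics/QuantumLattice/HubbardModel.lean`; it proves named facts
(`def X : Prop`, D-0014) of that file from Mathlib, the wave-0 glue and the CAR / `η`-algebra
proved in `FermionOperatorsProofs`. No statement is introduced or changed.

Proved here (namespace `Literature.QLattice`):

* `hamiltonian_mulVec_etaPairingState` — for the Hubbard Hamiltonian on ANY finite graph `G`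
  and any sign `ε` with `ε_x = -ε_y` on the edges of `G`, `H(t,U) (η†_ε)^m |0⟩ = m U (η†_ε)^m |0⟩`
  (induction on `m` from `[H, η†] = U η†` and `H |0⟩ = 0`); `etaPairingState_ne_zero`
  (`(η†)^m |0⟩ ≠ 0` for `m ≤ |Λ|`); the discharge `isNParticle_etaPairingState_holds`.
* `torusStagger_eq_neg_of_adj_holds` — discharge of the bipartiteness of the staggering sign
  `ε_x = (-1)^{Σ xᵢ}` on the torus `(ℤ/Lℤ)^d` of even side (parities compared through the ring
  map `ZMod L → ZMod 2`, which exists iff `2 ∣ L`).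
* `hubbardTorus_mulVec_etaPairingState_holds` — discharge of Yang's eigenvalue equation on the
  torus, and `etaRaise_commutator_holds` — discharge of Yang's commutator
  `[H(t,U) - μN, η†] = (U - 2μ) η†` on the torus of even side.

## Sources

C. N. Yang, *η pairing and off-diagonal long-range order in a Hubbard model*, PRL **63** (1989)
2144, eqs. (4)–(8): `η† = Σ_r e^{iπ·r} c†_{r↑} c†_{r↓}` on the periodic cube of even side,
`[H, η†] = 2W η†` (Yang's `2W` is `U` here), `ψ_N = (η†)^{N/2} |0⟩`, `H ψ_N = N W ψ_N`;
F. H. L. Essler et al., *The One-Dimensional Hubbard Model* (CUP 2005), §2.2.5 eqs. (2.80)–(2.87)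
("the invariance under the `η`-pairing symmetry holds only for an even number of lattice sites").
-/

noncomputable section

namespace Literature.MathematicalPhysics.QuantumLattice

open Matrix Finset Literature.Probability.LatticeModels

/-! ### The `η`-pairing states on a general bipartite graph -/

section Hubbard

variable {Λ : Type*} [LinearOrder Λ] [Fintype Λ]

/-- `(η†)^{m+1} |0⟩ = η† (η†)^m |0⟩`. Yang, PRL 63 (1989) 2144, eq. (7). [folklore] -/
theorem etaPairingState_succ (ε : Λ → ℤˣ) (m : ℕ) :
    etaPairingState ε (m + 1) = etaRaise ε *ᵥ etaPairingState ε m := by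
  rw [etaPairingState, etaPairingState, pow_succ', ← mulVec_mulVec]

/-- **Yang's `η`-pairing eigenstates on a bipartite graph.** For the Hubbard Hamiltonian `H(t, U)`
on any finite graph `G` and any sign `ε` with `ε_x = -ε_y` on every edge of `G`,
`H(t,U) (η†_ε)^m |0⟩ = m U · (η†_ε)^m |0⟩` for every `m` (induction on `m`, using
`[H, η†] = U η†` and `H |0⟩ = 0`). Yang, PRL 63 (1989) 2144, eqs. (6)–(8) (energy `N W = m U`
for `N = 2m`, `U = 2W`); Essler et al. (2005) §2.2.5. [cite: Yang1989, eqs. (6)–(8)] -/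
theorem hamiltonian_mulVec_etaPairingState (G : SimpleGraph Λ) [DecidableRel G.Adj] (ε : Λ → ℤˣ)
    (hε : ∀ x y, G.Adj x y → ε x = -ε y) (t U : ℝ) (m : ℕ) :
    hamiltonian G t U *ᵥ etaPairingState ε m = ((m * U : ℝ) : ℂ) • etaPairingState ε m := by
  induction m with
  | zero =>
    simp [etaPairingState, hamiltonian_mulVec_vacuum]
  | succ m ih =>
    have hcomm : hamiltonian G t U * etaRaise ε =
        etaRaise ε * hamiltonian G t U + (U : ℂ) • etaRaise ε := by
      rw [← hamiltonian_commutator_etaRaise G ε hε t U]; abel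
    rw [etaPairingState_succ, mulVec_mulVec, hcomm, add_mulVec, smul_mulVec, ← mulVec_mulVec, ih,
      mulVec_smul, ← add_smul]
    congr 1
    push_cast
    ring

/-- The `η`-pairing state with `m ≤ |Λ|` pairs is nonzero. Yang, PRL 63 (1989) 2144, eq. (7).
[cite: Yang1989, eq. (7)] -/
theorem etaPairingState_ne_zero (ε : Λ → ℤˣ) {m : ℕ} (hm : m ≤ Fintype.card Λ) :
    etaPairingState ε m ≠ 0 :=
  etaRaise_pow_mulVec_vacuum_ne_zero ε hm

end Hubbard

/-- **Discharge of `isNParticle_etaPairingState`**: the `η`-pairing state with `m` pairs has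
`2m` particles. Yang, PRL 63 (1989) 2144, eq. (7). [cite: Yang1989, eq. (7)] -/
theorem isNParticle_etaPairingState_holds : isNParticle_etaPairingState := by
  intro Λ _ _ ε m
  exact isNParticle_etaRaise_pow_mulVec_vacuum ε m

/-! ### The torus of even side is bipartite for the staggering sign -/

section Torus

variable {d L : ℕ}

/-- One lattice step flips the staggering sign on a torus of even side: if
`y ≡ x + eᵢ (mod L)` coordinatewise then `(-1)^{Σ yⱼ} = -(-1)^{Σ xⱼ}` (the coordinate sums,
read in `ZMod 2` through `ZMod L → ZMod 2`, differ by `1`). Lieb, PRL 62 (1989) 1201 (bipartite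
hypercubic lattices); Essler et al. (2005) §2.2.5 (even number of sites).
[cite: EsslerEtAl2005, §2.2.5] -/
theorem torusStagger_eq_neg_of_toTorusSite_eq (hL : Even L) {x y : FermionTorus d L} {i : Fin d}
    (h : FermionTorus.toTorusSite y = FermionTorus.toTorusSite x + Pi.single i 1) :
    torusStagger y = -torusStagger x := by
  have h2 : 2 ∣ L := even_iff_two_dvd.1 hL
  have hsum : ∑ j, ((ofLex y j : ℕ) : ZMod 2) = ∑ j, ((ofLex x j : ℕ) : ZMod 2) + 1 := by
    have := congrArg (fun v : TorusSite d L => ZMod.castHom h2 (ZMod 2) (∑ j, v j)) h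
    simp only [FermionTorus.toTorusSite_apply, Pi.add_apply, sum_add_distrib, map_add, map_sum,
      map_natCast, sum_pi_single', mem_univ, if_true, map_one] at this
    exact this
  have key : (∑ j, (ofLex y j : ℕ)) % 2 = (∑ j, (ofLex x j : ℕ) + 1) % 2 := by
    apply (ZMod.natCast_eq_natCast_iff' _ _ 2).1
    push_cast
    exact hsum
  -- `u ^ n = u ^ (n % 2)` for the power operation `Int.instUnitsPow` (by `ℕ`, through the `ℕ`-module
  -- `Additive ℤˣ`) that `torusStagger` elaborates to; definitionally the monoid power.
  have hmod : ∀ (u : ℤˣ) (n : ℕ), u ^ n = u ^ (n % 2) := fun u n =>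
    Int.units_pow_eq_pow_mod_two u n
  rw [torusStagger_apply, torusStagger_apply, hmod, key, ← hmod, uzpow_add, uzpow_one, mul_neg_one]

/-- **Discharge of `torusStagger_eq_neg_of_adj`**: on the fermionic torus `(ℤ/Lℤ)^d` of even
side `L`, nearest neighbours carry opposite staggering signs `ε_x = (-1)^{Σ xᵢ}` (the torus graph
is bipartite). Lieb, PRL 62 (1989) 1201, Theorem 2 (bipartite lattices); Essler et al. (2005)
§2.2.5. [cite: LiebPRL1989, Theorem 2 (bipartite lattice)] -/
theorem torusStagger_eq_neg_of_adj_holds : torusStagger_eq_neg_of_adj (d := d) (L := L) := by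
  intro hL x y h
  rw [fermionTorusGraph_adj, torusGraph_adj_iff] at h
  obtain ⟨-, ⟨i, hi⟩ | ⟨i, hi⟩⟩ := h
  · rw [torusStagger_eq_neg_of_toTorusSite_eq hL hi, neg_neg]
  · exact torusStagger_eq_neg_of_toTorusSite_eq hL hi

/-- **Discharge of `hubbardTorus_mulVec_etaPairingState`** (Yang's eigenvalue equation on the
torus): on `(ℤ/Lℤ)^d` with `L` even, `H(t,U) (η†)^m |0⟩ = m U (η†)^m |0⟩` for every `t`, `U`, `m`.
Yang, PRL 63 (1989) 2144, eq. (8). [cite: Yang1989, eq. (8)] -/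
theorem hubbardTorus_mulVec_etaPairingState_holds :
    hubbardTorus_mulVec_etaPairingState (d := d) (L := L) := by
  intro hL t U m
  exact hamiltonian_mulVec_etaPairingState _ _
    (fun x y h => torusStagger_eq_neg_of_adj_holds hL h) t U m

/-- **Discharge of `etaRaise_commutator`** (Yang's commutator on the torus of even side):
`[H(t,U) - μN, η†] = (U - 2μ) η†`, from `[H, η†] = U η†` (`hamiltonian_commutator_etaRaise`) and
`[N, η†] = 2η†` (`totalNumber_commutator_etaRaise_holds`). Yang, PRL 63 (1989) 2144, eq. (6);
Essler et al. (2005) §2.2.5, eqs. (2.84), (2.87). [cite: Yang1989, eq. (6)] -/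
theorem etaRaise_commutator_holds : etaRaise_commutator (d := d) (L := L) := by
  intro hL t U μ
  have hH := hamiltonian_commutator_etaRaise (fermionTorusGraph d L) torusStagger
    (fun x y h => torusStagger_eq_neg_of_adj_holds hL h) t U
  have hN := totalNumber_commutator_etaRaise_holds (Λ := FermionTorus d L) torusStagger
  rw [hubbardTorusWith_eq, hubbardTorus]
  calc (hamiltonian (fermionTorusGraph d L) t U - (μ : ℂ) • totalNumber) * etaRaise torusStagger -
        etaRaise torusStagger * (hamiltonian (fermionTorusGraph d L) t U - (μ : ℂ) • totalNumber)
      = (hamiltonian (fermionTorusGraph d L) t U * etaRaise torusStagger -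
            etaRaise torusStagger * hamiltonian (fermionTorusGraph d L) t U) -
          (μ : ℂ) • (totalNumber * etaRaise torusStagger - etaRaise torusStagger * totalNumber) := by
        rw [sub_mul, mul_sub, smul_mul_assoc, mul_smul_comm, smul_sub]
        abel
    _ = ((U - 2 * μ : ℝ) : ℂ) • etaRaise torusStagger := by
        rw [hH, hN, smul_smul, ← sub_smul]
        congr 1
        push_cast
        ring

end Torus

end Literature.MathematicalPhysics.QuantumLattice
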